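import Summits.CriticalPhenomena.PercolationContinuityZ3.Theorems.Transplant.FKConnectivityAllQForestTriangleClaw
import HarnessLib

/-!
# The END-TRIANGLE REDUCTION of the square-free adjacent forest Rayleigh node (♣)⁰ (vertex elimination at `v`)

Support file (`--supports stmt-CriticalPhenomena-4575`), FK sub-lane `prim-bschramm-fk-1` (generation 23) of the post-continuity programme;
builds on p205010 (kernel theorem, internal audit signed; external expert review pending).  No definitions, no named facts, no sorries;
standard axioms.

NODE (`AdjForestRayleighNoSqOn`): on every fibre `(M, u₀)` and for `e = ov`, `f = oy`, `#(Fo ∩ {e, f ∈ ω}, Fo) ≤ #(Fo ∩ {e ∈ ω}, Fo ∩ {f ∈ ω})`.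

THIS FILE (memo bschramm/FROM-fk-1-g23-VERTEX-ELIMINATION.md §3): the claw decomposition at the END `v` of `e` itself.  Since the events
track `e = vo`, only the four cells containing `vo` survive (**`fibreCount_forest_claw_decomp_mem`**, the claw decomposition with one TRACKED
pair).  If `v` has exactly the three free pairs `vo, vp, vq` and its two other neighbours are joined by a free pair `pq ≠ f`, then: the claw cell
is the node's count on the pinned fibre `(N ∪ {vo}, u₀ ∪ {vp, pq})` (`fibreCount_forest_claw_eq_pinned` with the tracked pair `vo = e`); the
cells `{vo, vp}` / `{vo, vq}` are the node's counts at the ADJACENT pairs `(op, f)` / `(oq, f)` conditioned on `o ↮ p` / `o ↮ q`; and the cell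
`{vo}` (partner separating `p, q`, i.e. `pq` pinned) contributes EQUALLY to both sides.  Hence **`adjForestNoSq_fibre_of_endTriangle`**
(conditioned form) and **`adjForestNoSq_fibre_of_endTriangle_free`**: if `op, oq` are not pairs of the fibre, the node's inequality at `(o; v, y)`
on `(N ∪ {pq, vo, vp, vq}, u₀)` follows from the node at `(o; v, y)` on `(N ∪ {vo}, u₀ ∪ {vp, pq})`, at `(o; p, y)` on `(N ∪ {pq, op}, u₀)` and at
`(o; q, y)` on `(N ∪ {pq, oq}, u₀)` — graph form `Φ(G; o; v, y) = ½Φ(G/vp; o; p, y) + Φ(G−v+op; o; p, y) + Φ(G−v+oq; o; q, y)`.  A minimal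
counterexample to (♣)⁰ therefore has no end `v` (or `y`) of degree 3 whose two other neighbours are adjacent (census: 4 / 18 / 263 further
3-connected instances at n = 7 / 8 / 9 beyond the triangle-claw reduction).
[cite: SempleWelsh2008, Conj. 1.1 (p. 2)] [cite: Linusson2011, Prop. 2.6] [cite: Grimmett2006, §1.5 (p. 13)]
-/

noncomputable section

namespace Summit.CriticalPhenomena.PercolationContinuityZ3.Theorems
namespace FK

open MeasureTheory Set Literature.Probability.LatticeModels Literature.Probability.Percolation
open scoped Classical symmDiff

variable {V : Type*} [Fintype V]

section ClawMem

variable {M' u₀ : BondConfig V} {z a b c : V} {P Q : Set (BondConfig V)}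

/-- **Claw decomposition with a tracked pair.**  `z` isolated in `M' ∪ u₀`, `z, a, b, c` distinct, `P, Q` blind to `za, zb, zc`.  On the
fibre `({za,zb,zc} ∪ M', u₀)`, counting only configurations CONTAINING `za`:
`#(Fo ∩ ({za ∈ ω} ∩ P), Fo ∩ Q) = #'(Fo ∩ S_abc ∩ P, Fo ∩ Q) + #'(Fo ∩ S_ab ∩ P, Fo ∩ Q) + #'(Fo ∩ S_ac ∩ P, Fo ∩ Q) + #'(Fo ∩ P, Fo ∩ S_bc ∩ Q)`
(`#'` on `(M', u₀)`; the cells `{za,zb,zc}`, `{za,zb}`, `{za,zc}`, `{za}`). [cite: Linusson2011, Prop. 2.6] [cite: Grimmett2006, §1.5 (p. 13)] -/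
theorem fibreCount_forest_claw_decomp_mem (hz : ∀ g ∈ M' ∪ u₀, z ∉ g) (hza : z ≠ a) (hzb : z ≠ b) (hzc : z ≠ c)
    (hab : a ≠ b) (hac : a ≠ c) (hbc : b ≠ c)
    (hPa : ∀ ω, insert s(z, a) ω ∈ P ↔ ω ∈ P) (hPb : ∀ ω, insert s(z, b) ω ∈ P ↔ ω ∈ P) (hPc : ∀ ω, insert s(z, c) ω ∈ P ↔ ω ∈ P)
    (hQb : ∀ ω, insert s(z, b) ω ∈ Q ↔ ω ∈ Q) (hQc : ∀ ω, insert s(z, c) ω ∈ Q ↔ ω ∈ Q) :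
    fibreCount (insert s(z, a) (insert s(z, b) (insert s(z, c) M'))) u₀ (forestEv V ∩ ({ω | s(z, a) ∈ ω} ∩ P)) (forestEv V ∩ Q) =
      fibreCount M' u₀ (forestEv V ∩ {ω | ¬ (openGraph ω).Reachable a b ∧ ¬ (openGraph ω).Reachable a c ∧
          ¬ (openGraph ω).Reachable b c} ∩ P) (forestEv V ∩ Q) +
      fibreCount M' u₀ (forestEv V ∩ {ω | ¬ (openGraph ω).Reachable a b} ∩ P) (forestEv V ∩ Q) +
      fibreCount M' u₀ (forestEv V ∩ {ω | ¬ (openGraph ω).Reachable a c} ∩ P) (forestEv V ∩ Q) +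
      fibreCount M' u₀ (forestEv V ∩ P) (forestEv V ∩ {ω | ¬ (openGraph ω).Reachable b c} ∩ Q) := by
  have hza' : s(z, a) ∉ insert s(z, b) (insert s(z, c) M') := by
    simp only [mem_insert_iff, not_or]
    exact ⟨fun h => hab (Sym2.congr_right.1 h), fun h => hac (Sym2.congr_right.1 h), fun h => hz _ (Or.inl h) (Sym2.mem_mk_left _ _)⟩
  have hzb' : s(z, b) ∉ insert s(z, c) M' := by
    simp only [mem_insert_iff, not_or]
    exact ⟨fun h => hbc (Sym2.congr_right.1 h), fun h => hz _ (Or.inl h) (Sym2.mem_mk_left _ _)⟩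
  have hzc' : s(z, c) ∉ M' := fun h => hz _ (Or.inl h) (Sym2.mem_mk_left _ _)
  have hiso : ∀ {ω : BondConfig V}, ω \ M' = u₀ → (∀ g ∈ ω, z ∉ g) ∧ (∀ g ∈ ω ∆ M', z ∉ g) := fun {ω} hω =>
    ⟨fun g hg => hz g ((subset_union_of_fibre hω).1 hg), fun g hg => hz g ((subset_union_of_fibre hω).2 hg)⟩
  rw [fibreCount_insert_one hza', fibreCount_insert_one hzb', fibreCount_insert_one hzb', fibreCount_insert_one hzc',
    fibreCount_insert_one hzc', fibreCount_insert_one hzc', fibreCount_insert_one hzc']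
  have pack : ∀ {ξ : BondConfig V}, (∀ g ∈ ξ, z ∉ g) →
      (s(z, a) ∉ ξ ∧ s(z, b) ∉ ξ ∧ s(z, c) ∉ ξ) ∧
      ((IsForestCfg (insert s(z, a) (insert s(z, b) (insert s(z, c) ξ))) ↔ IsForestCfg ξ ∧ ¬ (openGraph ξ).Reachable a b ∧
          ¬ (openGraph ξ).Reachable a c ∧ ¬ (openGraph ξ).Reachable b c) ∧
        (IsForestCfg (insert s(z, a) (insert s(z, b) ξ)) ↔ IsForestCfg ξ ∧ ¬ (openGraph ξ).Reachable a b) ∧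
        (IsForestCfg (insert s(z, a) (insert s(z, c) ξ)) ↔ IsForestCfg ξ ∧ ¬ (openGraph ξ).Reachable a c) ∧
        (IsForestCfg (insert s(z, b) (insert s(z, c) ξ)) ↔ IsForestCfg ξ ∧ ¬ (openGraph ξ).Reachable b c) ∧
        (IsForestCfg (insert s(z, a) ξ) ↔ IsForestCfg ξ) ∧ (IsForestCfg (insert s(z, b) ξ) ↔ IsForestCfg ξ) ∧
        (IsForestCfg (insert s(z, c) ξ) ↔ IsForestCfg ξ)) := by
    intro ξ hξ
    refine ⟨⟨notMem_of_isolated hξ a, notMem_of_isolated hξ b, notMem_of_isolated hξ c⟩, ?_, ?_, ?_, ?_,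
      isForestCfg_insert_of_isolated hξ hza, isForestCfg_insert_of_isolated hξ hzb, isForestCfg_insert_of_isolated hξ hzc⟩
    · rw [isForestCfg_insert_three_of_isolated hξ hzb hza hzc hab.symm hbc hac, SimpleGraph.reachable_comm (u := b) (v := a)]
      tauto
    · rw [isForestCfg_insert_two_of_isolated hξ hzb hza hab.symm, SimpleGraph.reachable_comm]
    · rw [isForestCfg_insert_two_of_isolated hξ hzc hza hac.symm, SimpleGraph.reachable_comm]
    · rw [isForestCfg_insert_two_of_isolated hξ hzc hzb hbc.symm, SimpleGraph.reachable_comm]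
  have hab' : s(z, a) ≠ s(z, b) := fun h => hab (Sym2.congr_right.1 h)
  have hac' : s(z, a) ≠ s(z, c) := fun h => hac (Sym2.congr_right.1 h)
  have hbc' : s(z, b) ≠ s(z, c) := fun h => hbc (Sym2.congr_right.1 h)
  -- the four live cells (containing `za`)
  have e1 : fibreCount M' u₀
      ({ω | s(z, c) ∉ ω} ∩ {ω | insert s(z, c) ω ∈ {ω | s(z, b) ∉ ω} ∩ {ω | insert s(z, b) ω ∈ {ω | s(z, a) ∉ ω} ∩
        {ω | insert s(z, a) ω ∈ forestEv V ∩ ({ω | s(z, a) ∈ ω} ∩ P)}}})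
      ({ω | s(z, c) ∉ ω} ∩ ({ω | s(z, b) ∉ ω} ∩ ({ω | s(z, a) ∉ ω} ∩ (forestEv V ∩ Q)))) =
      fibreCount M' u₀ (forestEv V ∩ {ω | ¬ (openGraph ω).Reachable a b ∧ ¬ (openGraph ω).Reachable a c ∧
          ¬ (openGraph ω).Reachable b c} ∩ P) (forestEv V ∩ Q) :=
    fibreCount_congr_fibre _ _ fun ω hω => by
      obtain ⟨⟨n1, n2, n3⟩, f3, fab, fac, fbc, fa, fb, fc⟩ := pack (hiso hω).1
      obtain ⟨⟨m1, m2, m3⟩, g3, gab, gac, gbc, ga, gb, gc⟩ := pack (hiso hω).2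
      simp only [mem_inter_iff, mem_setOf_eq, forestEv, mem_insert_iff, hab', hac', hbc', n1, n2, n3, m1, m2, m3, f3,
        hPa, hPb, hPc, not_false_eq_true, true_and, false_or, true_or]
  have e2 : fibreCount M' u₀
      ({ω | s(z, c) ∉ ω} ∩ ({ω | s(z, b) ∉ ω} ∩ {ω | insert s(z, b) ω ∈ {ω | s(z, a) ∉ ω} ∩
        {ω | insert s(z, a) ω ∈ forestEv V ∩ ({ω | s(z, a) ∈ ω} ∩ P)}}))
      ({ω | s(z, c) ∉ ω} ∩ {ω | insert s(z, c) ω ∈ {ω | s(z, b) ∉ ω} ∩ ({ω | s(z, a) ∉ ω} ∩ (forestEv V ∩ Q))}) =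
      fibreCount M' u₀ (forestEv V ∩ {ω | ¬ (openGraph ω).Reachable a b} ∩ P) (forestEv V ∩ Q) :=
    fibreCount_congr_fibre _ _ fun ω hω => by
      obtain ⟨⟨n1, n2, n3⟩, f3, fab, fac, fbc, fa, fb, fc⟩ := pack (hiso hω).1
      obtain ⟨⟨m1, m2, m3⟩, g3, gab, gac, gbc, ga, gb, gc⟩ := pack (hiso hω).2
      simp only [mem_inter_iff, mem_setOf_eq, forestEv, mem_insert_iff, hab', hac', hbc', n1, n2, n3, m1, m2, m3, fab, gc,
        hPa, hPb, hQc, not_false_eq_true, true_and, false_or, true_or]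
  have e3 : fibreCount M' u₀
      ({ω | s(z, c) ∉ ω} ∩ {ω | insert s(z, c) ω ∈ {ω | s(z, b) ∉ ω} ∩ ({ω | s(z, a) ∉ ω} ∩
        {ω | insert s(z, a) ω ∈ forestEv V ∩ ({ω | s(z, a) ∈ ω} ∩ P)})})
      ({ω | s(z, c) ∉ ω} ∩ ({ω | s(z, b) ∉ ω} ∩ {ω | insert s(z, b) ω ∈ {ω | s(z, a) ∉ ω} ∩ (forestEv V ∩ Q)})) =
      fibreCount M' u₀ (forestEv V ∩ {ω | ¬ (openGraph ω).Reachable a c} ∩ P) (forestEv V ∩ Q) :=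
    fibreCount_congr_fibre _ _ fun ω hω => by
      obtain ⟨⟨n1, n2, n3⟩, f3, fab, fac, fbc, fa, fb, fc⟩ := pack (hiso hω).1
      obtain ⟨⟨m1, m2, m3⟩, g3, gab, gac, gbc, ga, gb, gc⟩ := pack (hiso hω).2
      simp only [mem_inter_iff, mem_setOf_eq, forestEv, mem_insert_iff, hab', hac', hbc', n1, n2, n3, m1, m2, m3, fac, gb,
        hPa, hPc, hQb, not_false_eq_true, true_and, false_or, true_or]
  have e4 : fibreCount M' u₀
      ({ω | s(z, c) ∉ ω} ∩ ({ω | s(z, b) ∉ ω} ∩ ({ω | s(z, a) ∉ ω} ∩ {ω | insert s(z, a) ω ∈ forestEv V ∩ ({ω | s(z, a) ∈ ω} ∩ P)})))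
      ({ω | s(z, c) ∉ ω} ∩ {ω | insert s(z, c) ω ∈ {ω | s(z, b) ∉ ω} ∩ {ω | insert s(z, b) ω ∈ {ω | s(z, a) ∉ ω} ∩ (forestEv V ∩ Q)}}) =
      fibreCount M' u₀ (forestEv V ∩ P) (forestEv V ∩ {ω | ¬ (openGraph ω).Reachable b c} ∩ Q) :=
    fibreCount_congr_fibre _ _ fun ω hω => by
      obtain ⟨⟨n1, n2, n3⟩, f3, fab, fac, fbc, fa, fb, fc⟩ := pack (hiso hω).1
      obtain ⟨⟨m1, m2, m3⟩, g3, gab, gac, gbc, ga, gb, gc⟩ := pack (hiso hω).2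
      simp only [mem_inter_iff, mem_setOf_eq, forestEv, mem_insert_iff, hab', hac', hbc', n1, n2, n3, m1, m2, m3, fa, gbc,
        hPa, hQb, hQc, not_false_eq_true, true_and, false_or, true_or]
  -- the four dead cells (partner would contain `za`)
  have e5 : fibreCount M' u₀
      ({ω | s(z, c) ∉ ω} ∩ {ω | insert s(z, c) ω ∈ {ω | s(z, b) ∉ ω} ∩ {ω | insert s(z, b) ω ∈ {ω | s(z, a) ∉ ω} ∩
        (forestEv V ∩ ({ω | s(z, a) ∈ ω} ∩ P))}})
      ({ω | s(z, c) ∉ ω} ∩ ({ω | s(z, b) ∉ ω} ∩ ({ω | s(z, a) ∉ ω} ∩ {ω | insert s(z, a) ω ∈ forestEv V ∩ Q}))) = 0 :=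
    fibreCount_eq_zero_of_left _ _ (by
      rw [Set.eq_empty_iff_forall_notMem]
      intro ω hω
      simp only [mem_inter_iff, mem_setOf_eq, mem_insert_iff, hab', hac', false_or] at hω
      tauto) _
  have e6 : fibreCount M' u₀
      ({ω | s(z, c) ∉ ω} ∩ ({ω | s(z, b) ∉ ω} ∩ {ω | insert s(z, b) ω ∈ {ω | s(z, a) ∉ ω} ∩ (forestEv V ∩ ({ω | s(z, a) ∈ ω} ∩ P))}))
      ({ω | s(z, c) ∉ ω} ∩ {ω | insert s(z, c) ω ∈ {ω | s(z, b) ∉ ω} ∩ ({ω | s(z, a) ∉ ω} ∩ {ω | insert s(z, a) ω ∈ forestEv V ∩ Q})}) = 0 :=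
    fibreCount_eq_zero_of_left _ _ (by
      rw [Set.eq_empty_iff_forall_notMem]
      intro ω hω
      simp only [mem_inter_iff, mem_setOf_eq, mem_insert_iff, hab', false_or] at hω
      tauto) _
  have e7 : fibreCount M' u₀
      ({ω | s(z, c) ∉ ω} ∩ {ω | insert s(z, c) ω ∈ {ω | s(z, b) ∉ ω} ∩ ({ω | s(z, a) ∉ ω} ∩ (forestEv V ∩ ({ω | s(z, a) ∈ ω} ∩ P)))})
      ({ω | s(z, c) ∉ ω} ∩ ({ω | s(z, b) ∉ ω} ∩ {ω | insert s(z, b) ω ∈ {ω | s(z, a) ∉ ω} ∩ {ω | insert s(z, a) ω ∈ forestEv V ∩ Q}})) = 0 :=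
    fibreCount_eq_zero_of_left _ _ (by
      rw [Set.eq_empty_iff_forall_notMem]
      intro ω hω
      simp only [mem_inter_iff, mem_setOf_eq, mem_insert_iff, hac', false_or] at hω
      tauto) _
  have e8 : fibreCount M' u₀
      ({ω | s(z, c) ∉ ω} ∩ ({ω | s(z, b) ∉ ω} ∩ ({ω | s(z, a) ∉ ω} ∩ (forestEv V ∩ ({ω | s(z, a) ∈ ω} ∩ P)))))
      ({ω | s(z, c) ∉ ω} ∩ {ω | insert s(z, c) ω ∈ {ω | s(z, b) ∉ ω} ∩ {ω | insert s(z, b) ω ∈ {ω | s(z, a) ∉ ω} ∩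
        {ω | insert s(z, a) ω ∈ forestEv V ∩ Q}}}) = 0 :=
    fibreCount_eq_zero_of_left _ _ (by
      rw [Set.eq_empty_iff_forall_notMem]
      intro ω hω
      simp only [mem_inter_iff, mem_setOf_eq] at hω
      tauto) _
  rw [e1, e2, e3, e4, e5, e6, e7, e8]
  omega

end ClawMem

/-! ### The node at an end of degree three in a triangle -/

section EndTriangle

variable {N u₀ : BondConfig V} {v o p q : V} {f : Sym2 V}

/-- **(♣)⁰ AT AN END OF DEGREE THREE IN A TRIANGLE (conditioned form).**  Fibre `(N ∪ {pq, vo, vp, vq}, u₀)`: `v` isolated in `N ∪ u₀`,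
`pq ∉ N ∪ u₀` free, `v, o, p, q` distinct, `v ∉ f`, `pq ≠ f`.  If the node's inequality at `(e, f) = (ov, f)` holds on the pinned fibre
`(N ∪ {vo}, u₀ ∪ {vp, pq})` and the conditioned inequalities `#'(Fo ∩ {o ↮ p} ∩ {f ∈ ω}, Fo) ≤ #'(Fo ∩ {o ↮ p}, Fo ∩ {f ∈ ω})` (and the same
for `q`) hold on `(N ∪ {pq}, u₀)`, then `#(Fo ∩ {ov, f ∈ ω}, Fo) ≤ #(Fo ∩ {ov ∈ ω}, Fo ∩ {f ∈ ω})` on `(N ∪ {pq, vo, vp, vq}, u₀)`.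
[cite: SempleWelsh2008, Conj. 1.1 (p. 2)] [cite: Linusson2011, Prop. 2.6] [cite: Grimmett2006, §1.5 (p. 13)] -/
theorem adjForestNoSq_fibre_of_endTriangle (hv : ∀ g ∈ N ∪ u₀, v ∉ g) (hpqN : s(p, q) ∉ N) (hpqu : s(p, q) ∉ u₀)
    (hvo : v ≠ o) (hvp : v ≠ p) (hvq : v ≠ q) (hop : o ≠ p) (hoq : o ≠ q) (hpq : p ≠ q) (hfv : v ∉ f) (hfpq : s(p, q) ≠ f)
    (H1 : fibreCount (insert s(v, o) N) (insert s(v, p) (insert s(p, q) u₀)) (forestEv V ∩ {ω | s(o, v) ∈ ω ∧ f ∈ ω}) (forestEv V) ≤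
      fibreCount (insert s(v, o) N) (insert s(v, p) (insert s(p, q) u₀)) (forestEv V ∩ {ω | s(o, v) ∈ ω}) (forestEv V ∩ {ω | f ∈ ω}))
    (Hp : fibreCount (insert s(p, q) N) u₀ (forestEv V ∩ {ω | ¬ (openGraph ω).Reachable o p} ∩ {ω | f ∈ ω}) (forestEv V) ≤
      fibreCount (insert s(p, q) N) u₀ (forestEv V ∩ {ω | ¬ (openGraph ω).Reachable o p}) (forestEv V ∩ {ω | f ∈ ω}))
    (Hq : fibreCount (insert s(p, q) N) u₀ (forestEv V ∩ {ω | ¬ (openGraph ω).Reachable o q} ∩ {ω | f ∈ ω}) (forestEv V) ≤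
      fibreCount (insert s(p, q) N) u₀ (forestEv V ∩ {ω | ¬ (openGraph ω).Reachable o q}) (forestEv V ∩ {ω | f ∈ ω})) :
    fibreCount (insert s(v, o) (insert s(v, p) (insert s(v, q) (insert s(p, q) N)))) u₀ (forestEv V ∩ {ω | s(o, v) ∈ ω ∧ f ∈ ω})
        (forestEv V) ≤
      fibreCount (insert s(v, o) (insert s(v, p) (insert s(v, q) (insert s(p, q) N)))) u₀ (forestEv V ∩ {ω | s(o, v) ∈ ω})
        (forestEv V ∩ {ω | f ∈ ω}) := by
  have hov : s(o, v) = s(v, o) := Sym2.eq_swap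
  have hnf : ∀ x : V, s(v, x) ≠ f := fun x h => hfv (h ▸ Sym2.mem_mk_left _ _)
  have hU : ∀ (g : Sym2 V) (ω : BondConfig V), insert g ω ∈ (univ : Set (BondConfig V)) ↔ ω ∈ (univ : Set (BondConfig V)) :=
    fun g ω => by simp only [mem_univ]
  have hv' : ∀ g ∈ insert s(p, q) N ∪ u₀, v ∉ g := by
    rintro g hg hvg
    rcases hg with hg | hg
    · rcases mem_insert_iff.1 hg with rfl | hg
      · rcases Sym2.mem_iff.1 hvg with h | h
        · exact hvp h
        · exact hvq h
      · exact hv g (Or.inl hg) hvg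
    · exact hv g (Or.inr hg) hvg
  -- blindness of the events
  have bf : ∀ x : V, ∀ ω, insert s(v, x) ω ∈ {ω : BondConfig V | f ∈ ω} ↔ ω ∈ {ω : BondConfig V | f ∈ ω} :=
    fun x => insert_mem_pairEv_iff (hnf x)
  have bpq : ∀ ω, insert s(p, q) ω ∈ {ω : BondConfig V | f ∈ ω} ↔ ω ∈ {ω : BondConfig V | f ∈ ω} := insert_mem_pairEv_iff hfpq
  -- the decomposition of both sides (cells containing `vo` only)
  have DB := fibreCount_forest_claw_decomp_mem (P := {ω | f ∈ ω}) (Q := univ) hv' hvo hvp hvq hop hoq hpq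
    (bf o) (bf p) (bf q) (hU _) (hU _)
  have DG := fibreCount_forest_claw_decomp_mem (P := univ) (Q := {ω | f ∈ ω}) hv' hvo hvp hvq hop hoq hpq
    (hU _) (hU _) (hU _) (bf p) (bf q)
  have hB : forestEv V ∩ {ω : BondConfig V | s(o, v) ∈ ω ∧ f ∈ ω} = forestEv V ∩ ({ω | s(v, o) ∈ ω} ∩ {ω | f ∈ ω}) := by
    rw [hov]; rfl
  have hG : forestEv V ∩ {ω : BondConfig V | s(o, v) ∈ ω} = forestEv V ∩ ({ω | s(v, o) ∈ ω} ∩ univ) := by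
    rw [hov, Set.inter_univ]
  rw [hB, hG]
  simp only [Set.inter_univ] at DB DG ⊢
  rw [DB, DG]
  -- the claw cell: the node on the pinned fibre `(N ∪ {vo}, u₀ ∪ {vp, pq})`
  have K1 := fibreCount_forest_claw_eq_pinned (P := {ω | f ∈ ω}) (Q := univ) hv hpqN hpqu hvp hvq hvo hpq hop.symm
    (bf p) (bf o) bpq (hU _) (hU _)
  have K2 := fibreCount_forest_claw_eq_pinned (P := univ) (Q := {ω | f ∈ ω}) hv hpqN hpqu hvp hvq hvo hpq hop.symm
    (hU _) (hU _) (hU _) (bf p) bpq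
  simp only [Set.inter_univ] at K1 K2
  have hS : {ω : BondConfig V | ¬ (openGraph ω).Reachable o p ∧ ¬ (openGraph ω).Reachable o q ∧ ¬ (openGraph ω).Reachable p q} =
      {ω | ¬ (openGraph ω).Reachable p q ∧ ¬ (openGraph ω).Reachable p o ∧ ¬ (openGraph ω).Reachable q o} := by
    ext ω
    simp only [mem_setOf_eq, SimpleGraph.reachable_comm (u := p) (v := o), SimpleGraph.reachable_comm (u := q) (v := o)]
    tauto
  have hB1 : forestEv V ∩ {ω : BondConfig V | s(o, v) ∈ ω ∧ f ∈ ω} = forestEv V ∩ {ω | f ∈ ω} ∩ {ω | s(v, o) ∈ ω} := by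
    ext ω; simp only [mem_inter_iff, mem_setOf_eq, hov]; tauto
  have hG1 : forestEv V ∩ {ω : BondConfig V | s(o, v) ∈ ω} = forestEv V ∩ {ω | s(v, o) ∈ ω} := by rw [hov]
  rw [hB1, hG1, ← K1, ← K2] at H1
  rw [hS]
  -- the cell `{vo}`: `pq` pinned on the partner's side, equal contributions
  have A := fibreCount_forest_sep_of_mem (P := univ) (Q := {ω | f ∈ ω}) hpq hpqN hpqu (hU _) bpq
  have B := fibreCount_forest_sep_of_mem (P := {ω | f ∈ ω}) (Q := univ) hpq hpqN hpqu bpq (hU _)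
  simp only [Set.inter_univ] at A B
  have k4 : fibreCount (insert s(p, q) N) u₀ (forestEv V ∩ {ω | f ∈ ω}) (forestEv V ∩ {ω | ¬ (openGraph ω).Reachable p q}) =
      fibreCount (insert s(p, q) N) u₀ (forestEv V) (forestEv V ∩ {ω | ¬ (openGraph ω).Reachable p q} ∩ {ω | f ∈ ω}) := by
    rw [fibreCount_swap, A, fibreCount_swap _ _ (forestEv V) (forestEv V ∩ {ω | ¬ (openGraph ω).Reachable p q} ∩ {ω | f ∈ ω}), B,
      fibreCount_swap]
  omega

/-- **(♣)⁰ IS CLOSED UNDER MAKING AN END OF DEGREE THREE WHOSE TWO OTHER NEIGHBOURS ARE ADJACENT (fibre form, free side pairs).**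
Setting of `adjForestNoSq_fibre_of_endTriangle` with `op, oq` outside `N ∪ u₀` and `op, oq ≠ f`.  If the node's inequality holds at
`(ov, f)` on `(N ∪ {vo}, u₀ ∪ {vp, pq})`, at `(op, f)` on `(N ∪ {pq, op}, u₀)` and at `(oq, f)` on `(N ∪ {pq, oq}, u₀)`, then it holds at
`(ov, f)` on `(N ∪ {pq, vo, vp, vq}, u₀)`.  Graph form: `Φ(G; o; v, y) = ½Φ(G/vp; o; p, y) + Φ(G−v+op; o; p, y) + Φ(G−v+oq; o; q, y)`.
[cite: SempleWelsh2008, Conj. 1.1 (p. 2)] [cite: Linusson2011, Prop. 2.6] [cite: Grimmett2006, §1.5 (p. 13)] -/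
theorem adjForestNoSq_fibre_of_endTriangle_free (hv : ∀ g ∈ N ∪ u₀, v ∉ g) (hpqN : s(p, q) ∉ N) (hpqu : s(p, q) ∉ u₀)
    (hopN : s(o, p) ∉ N) (hopu : s(o, p) ∉ u₀) (hoqN : s(o, q) ∉ N) (hoqu : s(o, q) ∉ u₀)
    (hvo : v ≠ o) (hvp : v ≠ p) (hvq : v ≠ q) (hop : o ≠ p) (hoq : o ≠ q) (hpq : p ≠ q) (hfv : v ∉ f) (hfpq : s(p, q) ≠ f)
    (hfop : s(o, p) ≠ f) (hfoq : s(o, q) ≠ f)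
    (H1 : fibreCount (insert s(v, o) N) (insert s(v, p) (insert s(p, q) u₀)) (forestEv V ∩ {ω | s(o, v) ∈ ω ∧ f ∈ ω}) (forestEv V) ≤
      fibreCount (insert s(v, o) N) (insert s(v, p) (insert s(p, q) u₀)) (forestEv V ∩ {ω | s(o, v) ∈ ω}) (forestEv V ∩ {ω | f ∈ ω}))
    (H2 : fibreCount (insert s(o, p) (insert s(p, q) N)) u₀ (forestEv V ∩ {ω | s(o, p) ∈ ω ∧ f ∈ ω}) (forestEv V) ≤
      fibreCount (insert s(o, p) (insert s(p, q) N)) u₀ (forestEv V ∩ {ω | s(o, p) ∈ ω}) (forestEv V ∩ {ω | f ∈ ω}))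
    (H3 : fibreCount (insert s(o, q) (insert s(p, q) N)) u₀ (forestEv V ∩ {ω | s(o, q) ∈ ω ∧ f ∈ ω}) (forestEv V) ≤
      fibreCount (insert s(o, q) (insert s(p, q) N)) u₀ (forestEv V ∩ {ω | s(o, q) ∈ ω}) (forestEv V ∩ {ω | f ∈ ω})) :
    fibreCount (insert s(v, o) (insert s(v, p) (insert s(v, q) (insert s(p, q) N)))) u₀ (forestEv V ∩ {ω | s(o, v) ∈ ω ∧ f ∈ ω})
        (forestEv V) ≤
      fibreCount (insert s(v, o) (insert s(v, p) (insert s(v, q) (insert s(p, q) N)))) u₀ (forestEv V ∩ {ω | s(o, v) ∈ ω})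
        (forestEv V ∩ {ω | f ∈ ω}) := by
  have hopM : s(o, p) ∉ insert s(p, q) N := by
    rw [mem_insert_iff, not_or]
    refine ⟨fun h => ?_, hopN⟩
    have ho : o ∈ s(p, q) := h ▸ Sym2.mem_mk_left o p
    exact (Sym2.mem_iff.1 ho).elim hop hoq
  have hoqM : s(o, q) ∉ insert s(p, q) N := by
    rw [mem_insert_iff, not_or]
    refine ⟨fun h => ?_, hoqN⟩
    have ho : o ∈ s(p, q) := h ▸ Sym2.mem_mk_left o q
    exact (Sym2.mem_iff.1 ho).elim hop hoq
  -- one inserted adjacent pair `ox`, tracked: `#_{(M'+ox)}(Fo ∩ {ox ∈ ω} ∩ P, Fo ∩ Q) = #_{M'}(Fo ∩ {o ↮ x} ∩ P, Fo ∩ Q)`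
  have conv : ∀ {x : V} (hox : o ≠ x) (hM : s(o, x) ∉ insert s(p, q) N) (hu : s(o, x) ∉ u₀) (hfx : s(o, x) ≠ f),
      (fibreCount (insert s(o, x) (insert s(p, q) N)) u₀ (forestEv V ∩ {ω | s(o, x) ∈ ω ∧ f ∈ ω}) (forestEv V) =
        fibreCount (insert s(p, q) N) u₀ (forestEv V ∩ {ω | ¬ (openGraph ω).Reachable o x} ∩ {ω | f ∈ ω}) (forestEv V)) ∧
      (fibreCount (insert s(o, x) (insert s(p, q) N)) u₀ (forestEv V ∩ {ω | s(o, x) ∈ ω}) (forestEv V ∩ {ω | f ∈ ω}) =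
        fibreCount (insert s(p, q) N) u₀ (forestEv V ∩ {ω | ¬ (openGraph ω).Reachable o x}) (forestEv V ∩ {ω | f ∈ ω})) := by
    intro x hox hM hu hfx
    have hgω : ∀ {ω : BondConfig V}, ω \ insert s(p, q) N = u₀ → s(o, x) ∉ ω := fun {ω} hω h => (mem_union_of_fibre hω h).elim hM hu
    have hgζ : ∀ {ω : BondConfig V}, ω \ insert s(p, q) N = u₀ → s(o, x) ∉ ω ∆ insert s(p, q) N := fun {ω} hω h =>
      (mem_union_of_fibre_symmDiff hω h).elim hM hu
    have hins : ∀ {ω : BondConfig V}, s(o, x) ∉ ω → (IsForestCfg (insert s(o, x) ω) ↔ IsForestCfg ω ∧ ¬ (openGraph ω).Reachable o x) :=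
      fun h => isForestCfg_insert_iff hox h
    have hfm : ∀ {ω : BondConfig V}, f ∈ insert s(o, x) ω ↔ f ∈ ω := fun {ω} =>
      ⟨fun h => (mem_insert_iff.1 h).resolve_left hfx.symm, fun h => mem_insert_of_mem _ h⟩
    constructor
    · rw [fibreCount_insert_one hM]
      have e0 : fibreCount (insert s(p, q) N) u₀ ({ω | s(o, x) ∉ ω} ∩ (forestEv V ∩ {ω | s(o, x) ∈ ω ∧ f ∈ ω}))
          ({ω | s(o, x) ∉ ω} ∩ {ω | insert s(o, x) ω ∈ forestEv V}) = 0 :=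
        fibreCount_eq_zero_of_left _ _ (by
          rw [Set.eq_empty_iff_forall_notMem]
          rintro ω ⟨h1, -, h2, -⟩
          exact h1 h2) _
      rw [e0, add_zero]
      refine fibreCount_congr_fibre _ _ fun ω hω => ?_
      simp only [mem_inter_iff, mem_setOf_eq, forestEv, hins (hgω hω), hfm, mem_insert_iff, true_or, hgω hω, hgζ hω,
        not_false_eq_true, true_and]
    · rw [fibreCount_insert_one hM]
      have e0 : fibreCount (insert s(p, q) N) u₀ ({ω | s(o, x) ∉ ω} ∩ (forestEv V ∩ {ω | s(o, x) ∈ ω}))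
          ({ω | s(o, x) ∉ ω} ∩ {ω | insert s(o, x) ω ∈ forestEv V ∩ {ω | f ∈ ω}}) = 0 :=
        fibreCount_eq_zero_of_left _ _ (by
          rw [Set.eq_empty_iff_forall_notMem]
          rintro ω ⟨h1, -, h2⟩
          exact h1 h2) _
      rw [e0, add_zero]
      refine fibreCount_congr_fibre _ _ fun ω hω => ?_
      simp only [mem_inter_iff, mem_setOf_eq, forestEv, hins (hgω hω), mem_insert_iff, true_or, hgω hω, hgζ hω,
        not_false_eq_true, true_and, and_true]
  obtain ⟨cp1, cp2⟩ := conv hop hopM hopu hfop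
  obtain ⟨cq1, cq2⟩ := conv hoq hoqM hoqu hfoq
  rw [cp1, cp2] at H2
  rw [cq1, cq2] at H3
  exact adjForestNoSq_fibre_of_endTriangle hv hpqN hpqu hvo hvp hvq hop hoq hpq hfv hfpq H1 H2 H3

end EndTriangle

end FK
end Summit.CriticalPhenomena.PercolationContinuityZ3.Theorems

end
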